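import Summits.QuantumFields.YangMills.Theorems.UnitScaleTiltHalvingHStokesRowOfCombDefect
import HarnessLib

/-!
# Line H (`BirthV10.stub_halvingStep`, stmt-QuantumFields-19200) — (M2′), σ-EDITION OF THE (b)-ROW DOOR (B-al-3): ✓`hStokes_of_rows` with the chart guard `c′ ≤ cσ`
# threaded through the ∀-tails ([Balaban1985RegularSpaces] (1.42) p.83: on the top cube the chart radius is `c′ = 2L·c⋆ = O(s′)`, not the L-only guard value)

Cell `ym3-torus` (HUMAN RULING D-0037: YM₃ on T³ is ladder rung R3 — NOT d = 4, NOT infinite volume, NOT a mass gap, NOT the Clay problem), width seat `ym3-torus-px15` gen 4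
(LEAD-H ★w5-19200 g7 WORD 24 2026-08-29T05:59:06Z «σ-EDITION — pen (σ6): DOOR σ `hStokes_of_rows_σ` (✓p696030 + guard) → px15 g4»; px20 g5's LOCATE-THETA-BUDGET 74908ee8: with the
tail's chart letter known only through `8·3800((d+2)L)²c′ ≤ 1` the effective-gauge row forces `θG ≥ 1.2·10⁻³∕L⁶` while the closure needs `θb < 10⁻²⁷`; print's mechanism is
`c′ = 2L·c⋆`).  `--supports stmt-QuantumFields-19200 --as helper`; THEOREMS ONLY (0 `def`, 0 `sorry`); count-neutral; nothing here claims B-al-2, (B-al-4), (M2′), the stub,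
the crux or the gap — the four rows are HYPOTHESES.

WHAT.  ★★★ `hStokes_of_rows_σ` = ym-ust-20520-w3 g9's ✓`HalvingHStokesRowOfCombDefect.hStokes_of_rows` (proof and helpers reused BY NAME from that module) with ONE new outer real
`cσ` and ONE new antecedent `c' ≤ cσ →` inserted right after `8 * 3800 * ((((F.P K).d + 2) * (F.P K).L : ℕ) : ℝ) ^ 2 * c' ≤ 1 →` in (i) the ∀-tail of row `hG` ((B-al-4), whose
σ-supplier ✓`hG_of_rows_σ` needs it for the ω-row σ) and (ii) the ∀-tail of the CONCLUSION (= the σ-assembly's binder (b), H-side letter `c' ≤ 2 * ((F.P K).L * cstar)` after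
`cσ := 2 * ((F.P K).L * cstar)`); the proof threads `hcσ` from (ii) to (i), nothing else changes (rows `hCU hcmp hP`, numeric rows `hρk1 hθG1 hθb` VERBATIM).
HONEST SCOPE.  Bookkeeping; same scope as ✓p696030.

References: T. Bałaban, CMP **99** (1985) 75–102 [Balaban1985RegularSpaces] ((1.42) p.83, (1.29) p.81); CMP **98** (1985) 17–51 [Balaban1985Averaging]
((84) p.30, (89) p.31, (97)–(100) p.32, pp.24–25); CMP **102** (1985) 255–275 [Balaban1985UV3] ((27) p.263).
-/

set_option autoImplicit false

noncomputable section

namespace Summit.QuantumFields.YangMills.Theorems.HalvingHStokesRowOfCombDefectS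


open scoped BigOperators Matrix.Norms.L2Operator
open NormedSpace  open Complex (I)


open Literature.MathematicalPhysics.QuantumFieldTheory.Balaban1983to89  open Literature.MathematicalPhysics.QuantumFieldTheory.Balaban1983to89.T3ContinuumYM3Torus
open Literature.MathematicalPhysics.QuantumFieldTheory.Balaban1983to89.T3PrintedRegularMinimiser (RegPr regFibrePr)  open MatrixLog (mlog)  open B5Eq118OneStroke (iterBlockOf)  open B7Prop1Explicit (e expUnit)  open B7Prop1Explicit renaming Site → LSite
open B7Prop2Explicit (unitaryUnits C0 c2' avgIter)  open B7Prop2SpecialUnitary (specialUnitaryUnits mem_specialUnitaryUnits specialUnitaryUnits_le_unitaryUnits)  open B7Prop3Flat (c3)  open B7Prop10General (C6 C4G)  open B7Prop9Flat (C5')  open B7Prop1Local (InBox loK bondHiK)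
open B7Eq78Linearization (conjR zdBlocking QprimeIter)  open B7Eq92Concrete (mgauge)  open B8Ineq130 (tlo thi)  open B8Ineq132 (covDerivFwd InAk)
open B8Eq119TwistedAxial (Restr129 InAx bgT)  open B8Eq131Cubes (cube gs tLo tHi)  open B8Eq131CubesAdmissible (cubeFam)  open B8CubeMemberZd (cubeLamS cubeLamB)  open B8Eq184Proof (gaugeExp cfgExp)  open B8Eq182Proof (gAd)  open B8Eq188Proof (frakF3)  open B8Eq140Level (SideTouches)
open B8Eq146AExpansion (iEta)  open B8Eq138LandauZd (IsLandau138W covDivB covLap QT logCfg)  open B7Prop4GeneralLevels (logCovIter linCovIter)  open B8Eq155JBound (Jcur wsup)  open B8ScaledSupNorm (bondNorm msup)  open B8Ineq125Concrete (C2p)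
open B8Eq1117Concrete (XSpace)  open B9SupplySockB9P3ZdBeta (CrossB)  open B9SupplySockB9P3ZdGamma (cubeLamBP')  open B8Ineq132 (BondTouches)
open HalvingHSiteDatumRowsGamma (datumRowsγ h66_of_towerRow betaScalarRows)  open B8Prop5ContractionKLevel (Bd2 Mc Kc)  open B8LambdaSpaceKLevel (wt)  open B8Eq178Averages (Qnl)  open B8SpecialUnitaryTrace (trCLM trCLM_apply)
open B10Eq27TorusAxialLog (transl rel pull pull_apply unitsField toUField suIncl gaugeActT axialT unitsField_mem_unitaryUnits)  open B15Eq112TorusCover (lift cover)  open Node00 (coverAt)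
open LatticeFieldCalculus (siteAvgIter)  open Summit.QuantumFields.YangMills.Theorems.Prop8ChartDoubleBar (dbarIterU vframeU)  open P1FlatCoreCubeInclusion (corner_of_offset)  open HalvingP1FlatCoreSupplierAssembly (hchartTop_of_hdat hc₁_of_small)
open HalvingHSiteSizeRowsOfTopRowsGamma (siteSizeRows_of_topRows_γ)  open HalvingHSiteTopKnit (hknit_of_descent)  open HalvingHSiteDatumOfSocketsTGammaTree (siteDatum_of_T4Tγ_tree)  open B8Lemma1NonAbelian (lowPart)  open HalvingHSiteTopH42OfRowsGammaD (H42_of_rows_γD)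
open HalvingHSiteTopKnitBP (hknit_of_descent_BP')  open B8CubeMemberZd (hΩ_cubeFam)  open B8SockHFPCubeMember (htw_cubeLamS h8lt_cubeLamS h8top_cubeLamS)  open B8Prop6OfThm4 (one_inAk)
open HalvingP1FlatCoreSupplierRestr129 (restr129_product_of_topRows)  open HalvingP1FlatCoreSupplierInduction (h34_of_inAk_univ hAx_of_inAx_one)  open B8Prop5SocketDatum (restr129_succ_of_truncation)  open P1FlatCoreTopH42Gamma (cubeLamB_top_subset_cubeLamBP')  open B7Prop4Flat (C2 c4)  open HalvingHSiteTopOfDatumGamma (siteTop_of_datum_γ)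

open B7Prop5Flat (BondIn)  open B7Prop1Local (AgreeOn)  open B7Eq92Concrete (tildIter tildIter_apply tHol)  open B7Eq84Concrete (uavg)
open B7Prop1Explicit (treeWord boxVec)  open B8Ineq132 (Under avgIter_one)  open B8Eq131Derivation (ax119_iff_ax67)  open B8Ineq172Concrete (tHol_block_congr)
open B8Eq142KLevelLocal (inBox_box_of_tower_fst inBox_box_of_tower_snd)  open B8CubeMemberLamBPrimeLaws (cubeLamBP'_hbox_pred cubeLamBP'_hclass)
open B8Eq131CubesAdmissible (cubeFam_false_of_le)  open B8CubeMemberZd (cubeLamS_self)  open B8Eq131Cubes (mem_cube_iff cube_anti)  open B8Eq140Level (sideTouches_of_bondTouches)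
open B7Prop1Local (avgIter_congr)  open B7Prop3Flat (expCfg)
open HalvingTopCrossingQkOfDefect (norm_logCovIter_succ_lt_crossing_of_defect_loc uavg_succ_eq_one_of_restr129_box agreeOn_of_subbox)
open HalvingHSiteTopRowsOfSocketsGamma (h135_cubeMember_γ)  open P1FlatCoreTopTargetRep (rep_cover_eq_of_mem_cube)  open HalvingP1FlatCoreSupplierGaugeDescent (gaugeActT_mul_left)
open HalvingCompetitorMapFibre (unitsField_toUField_gaugeAct)  open P1FlatCoreCubeInclusion (transl_zero_eq_cover)  open B10Eq27TorusAxialLog (transl_add_e)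
open B7Eq92Concrete (mgauge_apply Rc_one_apply)  open Summit.QuantumFields.YangMills.Theorems (FlatMinimizerH.le_T3)

open HalvingTreeAxialStokes (norm_axialFn_sub_one_le_of_treeAxial)
open B7Prop1Explicit (U1 mem_U1 hol hol_cons hol_nil stepHol stepHol_true stepHol_false Letter hol_mem norm_inv_sub_one_le axialFn l1)
open P1FlatCoreFrameLinTower (dbarIterU_gaugeActT_eq_effGauge)  open B10Eq27TorusAxialLog (gaugeActT_apply holT)  open Prop7AxialGauge (axialT_gaugeActT holT_gaugeActT)
open B7Prop7LinearBound (norm_units_inv_sub_one_le_two_mul)  open B10Eq27TorusAxialLog (axialFn_pull_rel transl_apply)  open B7Prop1Explicit (length_treeWord)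
open B8Eq131Cubes (sqLo sqHi bLo bHi)  open B8CubeMemberZd (inBox_sq_of_mem_cubeLamS)
open HalvingHSiteTorusBlocks (rel_coverAt_eq l1_rel_coverAt_le walk_treeWord_subset_territory coverAt_mem_territory two_mul_le_sitesPerDir_of_room)


open HalvingHStokesRowOfCombDefect (norm_hol_sub_hol_le hol_comp_add norm_sub_le_of_norm_inv_mul_sub_one_le)

variable (F : T3Family) {n K : ℕ}

set_option maxHeartbeats 400000 in /-- ★★★ **σ-EDITION OF THE (b)-ROW DOOR** (LEAD-H WORD 24: the chart guard `c' ≤ cσ` threaded through the ∀-tail of row `hG` AND of the conclusion, `cσ` an outer real the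
knit instantiates at `2·((F.P K).L·c⋆)`; everything else = ✓`hStokes_of_rows` VERBATIM) — the conclusion is the assembly's `hStokes` binder
(✓p691225 `HalvingH42TopCrossAssembly.h42topCrossT_of_dictionary_and_stokes`, (b)) VERBATIM; rows `hCU` (comb average `U1`-valued), `hcmp` (double bar vs comb average,
`ρk`), `hP` (comb plaquettes `p` on the territory `[tLo, tHi]`), `hG` (effective gauge of `u₁⁻¹` within `θG` of `1`), numeric rows `hρk1 hθG1 hθb`.
[cite: Balaban1985Averaging, (84) p.30, (89) p.31, pp.24-25; Balaban1985RegularSpaces, (1.29) p.81] -/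
theorem hStokes_of_rows_σ (x₀ : Site (F.P K) 0) {a : LSite (F.P K).d} {M' ρ' : ℕ} (hM' : 1 ≤ M')
    (ha : ∀ ν, a ν ≤ ((iterBlockOf (K - n) x₀ ν).val : ℤ) ∧ ((iterBlockOf (K - n) x₀ ν).val : ℤ) ≤ a ν + M' - 1)
    (hroomW : 2 * ((F.P K).L ^ (K - n) * (M' + 1) + ρ' * gs (F.P K).L (K - n)) ≤ (F.P K).sitesPerDir 0)
    (U : GaugeField (F.P K) 0 (Matrix.specialUnitaryGroup (Fin 2) ℂ))
    {ε₀ s α₄ θb p ρk θG : ℝ} (cσ : ℝ) (hp0 : 0 ≤ p) (hρk0 : 0 ≤ ρk) (hθG0 : 0 ≤ θG) (hρk1 : ((F.P K).d : ℝ) * (M' + ρ') * ρk ≤ 1 / 8) (hθG1 : θG ≤ 1 / 8)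
    (hθb : 2 * (((F.P K).d : ℝ) * (M' + ρ') * ((F.P K).d * ((M' : ℝ) - 1 + 4 * ρ') * p + 4 * ρk)) + 3 * θG ≤ θb)
    -- ROW (R-U): the comb average is `U1`-valued (lit ✓`B7Prop2Explicit.avgIter_mem` from `InAk`'s plaquette smallness + Prop. 4's windows)
    (hCU : ∀ (gJ : GaugeTransf (F.P K) 0 (Matrix.specialUnitaryGroup (Fin 2) ℂ)),
      InAk (F.P K).L (K - n) (((F.L : ℝ)⁻¹) ^ (K - n)) ε₀ (fun _ => (Set.univ : Set (LSite (F.P K).d))) (pull (unitsField (toUField (GaugeField.gaugeAct gJ U))) 0) →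
      (∀ m', m' ≤ K - n → ∀ Λ : ℕ → Set (LSite (F.P K).d), InAx (F.P K).L m' Λ (1 : LSite (F.P K).d → Fin (F.P K).d → (Matrix (Fin 2) (Fin 2) ℂ)ˣ) (pull (unitsField (toUField (GaugeField.gaugeAct gJ U))) 0)) →
      ∀ (z : LSite (F.P K).d) (ν : Fin (F.P K).d), avgIter (F.P K).L (pull (unitsField (toUField (GaugeField.gaugeAct gJ U))) 0) (K - n) z ν ∈ U1 (Matrix (Fin 2) (Fin 2) ℂ))
    -- ROW (R-cmp): B-al-2's H_k (★w3-19200 g10 `comb_eq_dbar_mul_defect`, Φ = 1): the torus double bar and the ℤᵈ comb average of `U′` agree bondwise within `ρk`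
    (hcmp : ∀ (gJ : GaugeTransf (F.P K) 0 (Matrix.specialUnitaryGroup (Fin 2) ℂ)),
      InAk (F.P K).L (K - n) (((F.L : ℝ)⁻¹) ^ (K - n)) ε₀ (fun _ => (Set.univ : Set (LSite (F.P K).d))) (pull (unitsField (toUField (GaugeField.gaugeAct gJ U))) 0) →
      (∀ m', m' ≤ K - n → ∀ Λ : ℕ → Set (LSite (F.P K).d), InAx (F.P K).L m' Λ (1 : LSite (F.P K).d → Fin (F.P K).d → (Matrix (Fin 2) (Fin 2) ℂ)ˣ) (pull (unitsField (toUField (GaugeField.gaugeAct gJ U))) 0)) →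
      ∀ (z : LSite (F.P K).d) (ν : Fin (F.P K).d),
        ‖((((dbarIterU (K - n) (unitsField (toUField (GaugeField.gaugeAct gJ U))) ⟨coverAt (F.P K) (K - n) z, ν⟩)⁻¹ * avgIter (F.P K).L (pull (unitsField (toUField (GaugeField.gaugeAct gJ U))) 0) (K - n) z ν) : (Matrix (Fin 2) (Fin 2) ℂ)ˣ) : (Matrix (Fin 2) (Fin 2) ℂ)) - 1‖ ≤ ρk)
    -- ROW (R-P): the comb average's plaquettes on the territory (★w3-19200 g10's corollary `plaqSmall_avgIter_pull_of_mem_fibre`)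
    (hP : ∀ (gJ : GaugeTransf (F.P K) 0 (Matrix.specialUnitaryGroup (Fin 2) ℂ)),
      InAk (F.P K).L (K - n) (((F.L : ℝ)⁻¹) ^ (K - n)) ε₀ (fun _ => (Set.univ : Set (LSite (F.P K).d))) (pull (unitsField (toUField (GaugeField.gaugeAct gJ U))) 0) →
      (∀ m', m' ≤ K - n → ∀ Λ : ℕ → Set (LSite (F.P K).d), InAx (F.P K).L m' Λ (1 : LSite (F.P K).d → Fin (F.P K).d → (Matrix (Fin 2) (Fin 2) ℂ)ˣ) (pull (unitsField (toUField (GaugeField.gaugeAct gJ U))) 0)) →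
      B8Lemma1NonAbelian.PlaqSmall (avgIter (F.P K).L (pull (unitsField (toUField (GaugeField.gaugeAct gJ U))) 0) (K - n)) (tLo a ρ') (tHi a M' ρ') p)
    -- ROW (R-G): (B-al-4) — under the binder's own field∕datum guards (InAk, InAx, tower, top-axial, SU(2), (R1) `mgauge 1 u₁ W = U′`, chart rows, (R2) Restr129),
    -- the effective gauge of `u₁⁻¹` down `X̂`'s double-bar tower is within `θG` of `1` at the base block and on the top cube
    (hG : ∀ (gJ : GaugeTransf (F.P K) 0 (Matrix.specialUnitaryGroup (Fin 2) ℂ)) (u₁ : LSite (F.P K).d → (Matrix (Fin 2) (Fin 2) ℂ)ˣ)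
        (W : LSite (F.P K).d → Fin (F.P K).d → (Matrix (Fin 2) (Fin 2) ℂ)ˣ) (A : LSite (F.P K).d → Fin (F.P K).d → Matrix (Fin 2) (Fin 2) ℂ) (c₁ c' : ℝ),
      InAk (F.P K).L (K - n) (((F.L : ℝ)⁻¹) ^ (K - n)) ε₀ (fun _ => (Set.univ : Set (LSite (F.P K).d))) (pull (unitsField (toUField (GaugeField.gaugeAct gJ U))) 0) →
      (∀ m', m' ≤ K - n → ∀ Λ : ℕ → Set (LSite (F.P K).d), InAx (F.P K).L m' Λ (1 : LSite (F.P K).d → Fin (F.P K).d → (Matrix (Fin 2) (Fin 2) ℂ)ˣ) (pull (unitsField (toUField (GaugeField.gaugeAct gJ U))) 0)) →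
      (∀ m', m' ≤ K - n → ∀ (x : LSite (F.P K).d) (ν : Fin (F.P K).d), tlo (F.P K).L (tLo a ρ') m' ≤ x → x + e ν ≤ thi (F.P K).L (tHi a M' ρ') m' →
        ‖((avgIter (F.P K).L (pull (unitsField (toUField (GaugeField.gaugeAct gJ U))) 0) (K - n - m') x ν : (Matrix (Fin 2) (Fin 2) ℂ)ˣ) : Matrix (Fin 2) (Fin 2) ℂ) - 1‖ < s) →
      (∀ (x : LSite (F.P K).d) (ν : Fin (F.P K).d), tLo a ρ' ≤ x → x + e ν ≤ tHi a M' ρ' → lowPart ν (x - tLo a ρ') = 0 →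
        avgIter (F.P K).L (pull (unitsField (toUField (GaugeField.gaugeAct gJ U))) 0) (K - n) x ν = 1) →
      (∀ z, ((u₁ z : (Matrix (Fin 2) (Fin 2) ℂ)ˣ) : Matrix (Fin 2) (Fin 2) ℂ) ∈ Matrix.specialUnitaryGroup (Fin 2) ℂ) →
      mgauge (1 : LSite (F.P K).d → Fin (F.P K).d → (Matrix (Fin 2) (Fin 2) ℂ)ˣ) u₁ W = pull (unitsField (toUField (GaugeField.gaugeAct gJ U))) 0 →
      0 ≤ c' → 8 * 3800 * ((((F.P K).d + 2) * (F.P K).L : ℕ) : ℝ) ^ 2 * c' ≤ 1 → c' ≤ cσ → Real.exp c₁ - 1 ≤ ((F.L : ℝ)⁻¹) ^ (K - n) * c' →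
      (∀ z ∈ cube (F.P K).L a M' ρ' (K - n) (K - n), ∀ ν : Fin (F.P K).d, W z ν = cfgExp (((F.L : ℝ)⁻¹) ^ (K - n)) A z ν ∧ ((F.L : ℝ)⁻¹) ^ (K - n) * ‖A z ν‖ ≤ c₁) →
      Restr129 (F.P K).L (K - n) (cubeLamS (F.P K).L a M' ρ' (K - n) (K - n)) (1 : LSite (F.P K).d → Fin (F.P K).d → (Matrix (Fin 2) (Fin 2) ℂ)ˣ) u₁ →
      ∀ (κ : (i : ℕ) → GaugeTransf (F.P K) i (Matrix (Fin 2) (Fin 2) ℂ)ˣ),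
        (κ 0 = fun s => (u₁ (lift (F.P K) x₀ + rel x₀ s))⁻¹) →
        (∀ (i : ℕ) (y : Site (F.P K) (i + 1)),
          κ (i + 1) y = (vframeU (gaugeActT (κ i) (dbarIterU i (unitsField (toUField (GaugeField.gaugeAct gJ U))))) y)⁻¹ * κ i (emb y) * vframeU (dbarIterU i (unitsField (toUField (GaugeField.gaugeAct gJ U)))) y) →
        ‖((κ (K - n) (iterBlockOf (K - n) x₀) : (Matrix (Fin 2) (Fin 2) ℂ)ˣ) : (Matrix (Fin 2) (Fin 2) ℂ)) - 1‖ ≤ θG ∧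
        ∀ yc ∈ cubeLamS (F.P K).L a M' ρ' (K - n) (K - n) (K - n), ‖((κ (K - n) (coverAt (F.P K) (K - n) yc) : (Matrix (Fin 2) (Fin 2) ℂ)ˣ) : (Matrix (Fin 2) (Fin 2) ℂ)) - 1‖ ≤ θG) :
        ∀ (gJ : GaugeTransf (F.P K) 0 (Matrix.specialUnitaryGroup (Fin 2) ℂ)) (u₁ : LSite (F.P K).d → (Matrix (Fin 2) (Fin 2) ℂ)ˣ)
        (W : LSite (F.P K).d → Fin (F.P K).d → (Matrix (Fin 2) (Fin 2) ℂ)ˣ) (A : LSite (F.P K).d → Fin (F.P K).d → Matrix (Fin 2) (Fin 2) ℂ) (c₁ c' : ℝ)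
        (κf : (Site (F.P K) 0 → Matrix (Fin 2) (Fin 2) ℂ) → (i : ℕ) → GaugeTransf (F.P K) i (Matrix (Fin 2) (Fin 2) ℂ)ˣ) (lam : LSite (F.P K).d → Matrix (Fin 2) (Fin 2) ℂ),
      InAk (F.P K).L (K - n) (((F.L : ℝ)⁻¹) ^ (K - n)) ε₀ (fun _ => (Set.univ : Set (LSite (F.P K).d))) (pull (unitsField (toUField (GaugeField.gaugeAct gJ U))) 0) →
      (∀ m', m' ≤ K - n → ∀ Λ : ℕ → Set (LSite (F.P K).d), InAx (F.P K).L m' Λ (1 : LSite (F.P K).d → Fin (F.P K).d → (Matrix (Fin 2) (Fin 2) ℂ)ˣ) (pull (unitsField (toUField (GaugeField.gaugeAct gJ U))) 0)) →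
      (∀ m', m' ≤ K - n → ∀ (x : LSite (F.P K).d) (ν : Fin (F.P K).d), tlo (F.P K).L (tLo a ρ') m' ≤ x → x + e ν ≤ thi (F.P K).L (tHi a M' ρ') m' →
        ‖((avgIter (F.P K).L (pull (unitsField (toUField (GaugeField.gaugeAct gJ U))) 0) (K - n - m') x ν : (Matrix (Fin 2) (Fin 2) ℂ)ˣ) : Matrix (Fin 2) (Fin 2) ℂ) - 1‖ < s) →
      (∀ (x : LSite (F.P K).d) (ν : Fin (F.P K).d), tLo a ρ' ≤ x → x + e ν ≤ tHi a M' ρ' → lowPart ν (x - tLo a ρ') = 0 →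
        avgIter (F.P K).L (pull (unitsField (toUField (GaugeField.gaugeAct gJ U))) 0) (K - n) x ν = 1) →
      (∀ z, ((u₁ z : (Matrix (Fin 2) (Fin 2) ℂ)ˣ) : Matrix (Fin 2) (Fin 2) ℂ) ∈ Matrix.specialUnitaryGroup (Fin 2) ℂ) →
      mgauge (1 : LSite (F.P K).d → Fin (F.P K).d → (Matrix (Fin 2) (Fin 2) ℂ)ˣ) u₁ W = pull (unitsField (toUField (GaugeField.gaugeAct gJ U))) 0 →
      0 ≤ c' → 8 * 3800 * ((((F.P K).d + 2) * (F.P K).L : ℕ) : ℝ) ^ 2 * c' ≤ 1 → c' ≤ cσ → Real.exp c₁ - 1 ≤ ((F.L : ℝ)⁻¹) ^ (K - n) * c' →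
      (∀ z ∈ cube (F.P K).L a M' ρ' (K - n) (K - n), ∀ ν : Fin (F.P K).d, W z ν = cfgExp (((F.L : ℝ)⁻¹) ^ (K - n)) A z ν ∧ ((F.L : ℝ)⁻¹) ^ (K - n) * ‖A z ν‖ ≤ c₁) →
      (∀ (m : Site (F.P K) 0 → Matrix (Fin 2) (Fin 2) ℂ) (i : ℕ) (y : Site (F.P K) (i + 1)), κf m (i + 1) y = (vframeU (gaugeActT (κf m i) (dbarIterU i (gaugeActT
          (fun s => (u₁ (lift (F.P K) x₀ + rel x₀ s))⁻¹ * Unitary.toUnits (suIncl (gJ s)) : GaugeTransf (F.P K) 0 (Matrix (Fin 2) (Fin 2) ℂ)ˣ)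
          (unitsField (toUField U))))) y)⁻¹ * κf m i (emb y) * vframeU (dbarIterU i (gaugeActT
            (fun s => (u₁ (lift (F.P K) x₀ + rel x₀ s))⁻¹ * Unitary.toUnits (suIncl (gJ s)) : GaugeTransf (F.P K) 0 (Matrix (Fin 2) (Fin 2) ℂ)ˣ) (unitsField (toUField U)))) y) →
      (∀ (m : Site (F.P K) 0 → Matrix (Fin 2) (Fin 2) ℂ) (x : Site (F.P K) 0), ((κf m 0 x : (Matrix (Fin 2) (Fin 2) ℂ)ˣ) : Matrix (Fin 2) (Fin 2) ℂ) = exp (m x)) →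
      (∀ x, IsSelfAdjoint (lam x)) → (∀ x, (lam x).trace = 0) → (∀ yc ∈ cubeLamS (F.P K).L a M' ρ' (K - n) (K - n) (K - n),
        κf (((-I) • lam) ∘ fun s : Site (F.P K) 0 => lift (F.P K) x₀ + rel x₀ s) (K - n) (coverAt (F.P K) (K - n) yc) = axialT (dbarIterU (K - n) (gaugeActT
            (fun s => (u₁ (lift (F.P K) x₀ + rel x₀ s))⁻¹ * Unitary.toUnits (suIncl (gJ s)) : GaugeTransf (F.P K) 0 (Matrix (Fin 2) (Fin 2) ℂ)ˣ)
            (unitsField (toUField U)))) (iterBlockOf (K - n) x₀) (coverAt (F.P K) (K - n) yc)) →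
      (∀ j, j ≤ K - n → ∀ b ∈ {b : LSite (F.P K).d × Fin (F.P K).d | SideTouches ((cubeFam false (F.P K).L a M' ρ' (K - n)) j) b.1 b.2},
        ‖lam b.1‖ ≤ α₄ ∧ wt (F.P K).L (((F.L : ℝ)⁻¹) ^ (K - n)) j * ‖covDerivFwd (((F.L : ℝ)⁻¹) ^ (K - n)) (1 : LSite (F.P K).d → Fin (F.P K).d → (Matrix (Fin 2) (Fin 2) ℂ)ˣ) b.2 lam b.1‖ ≤ α₄) →
      Restr129 (F.P K).L (K - n) (cubeLamS (F.P K).L a M' ρ' (K - n) (K - n)) (1 : LSite (F.P K).d → Fin (F.P K).d → (Matrix (Fin 2) (Fin 2) ℂ)ˣ) u₁ →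
      Restr129 (F.P K).L (K - n) (Function.update (cubeLamS (F.P K).L a M' ρ' (K - n) (K - n)) (K - n) ∅) (1 : LSite (F.P K).d → Fin (F.P K).d → (Matrix (Fin 2) (Fin 2) ℂ)ˣ) (u₁ * gaugeExp lam) →
      ∀ yc ∈ cubeLamS (F.P K).L a M' ρ' (K - n) (K - n) (K - n),
        ‖((axialT (dbarIterU (K - n) (gaugeActT
            (fun s => (u₁ (lift (F.P K) x₀ + rel x₀ s))⁻¹ * Unitary.toUnits (suIncl (gJ s)) : GaugeTransf (F.P K) 0 (Matrix (Fin 2) (Fin 2) ℂ)ˣ)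
            (unitsField (toUField U)))) (iterBlockOf (K - n) x₀) (coverAt (F.P K) (K - n) yc) : (Matrix (Fin 2) (Fin 2) ℂ)ˣ) : Matrix (Fin 2) (Fin 2) ℂ) - 1‖ ≤ θb := by
  intro gJ u₁ W A c₁ c' κf lam hInAk hInAx htower htopax hu₁SU hW hc'0 hwin8 hcσ hexp hcube hκfs hκf0 hsa htr hknit hlam h129 h129' yc hyc
  -- LETTERS
  have hk : K - n ≤ (F.P K).m + (F.P K).K := by have := F.hm; have := FlatMinimizerH.le_T3 F n K; omega
  set X : GaugeField (F.P K) 0 (Matrix (Fin 2) (Fin 2) ℂ)ˣ := unitsField (toUField (GaugeField.gaugeAct gJ U)) with hXdef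
  obtain ⟨uh, huh⟩ : ∃ uh : GaugeTransf (F.P K) 0 (Matrix (Fin 2) (Fin 2) ℂ)ˣ, uh = fun s => (u₁ (lift (F.P K) x₀ + rel x₀ s))⁻¹ := ⟨_, rfl⟩
  -- the knit field is `X` gauged by `uh`
  have hWhat : gaugeActT (fun s => (u₁ (lift (F.P K) x₀ + rel x₀ s))⁻¹ * Unitary.toUnits (suIncl (gJ s)) :
      GaugeTransf (F.P K) 0 (Matrix (Fin 2) (Fin 2) ℂ)ˣ) (unitsField (toUField U)) = gaugeActT uh X := by
    funext b
    rw [gaugeActT_mul_left, hXdef, unitsField_toUField_gaugeAct, gaugeActT_apply uh, huh]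
  rw [hWhat]
  -- the effective-gauge family of `uh` down the double-bar tower of `X`
  let κ : (i : ℕ) → GaugeTransf (F.P K) i (Matrix (Fin 2) (Fin 2) ℂ)ˣ := fun i =>
    Nat.rec (motive := fun i => GaugeTransf (F.P K) i (Matrix (Fin 2) (Fin 2) ℂ)ˣ) uh
      (fun i κi => fun y => (vframeU (gaugeActT κi (dbarIterU i X)) y)⁻¹ * κi (emb y) * vframeU (dbarIterU i X) y) i
  have hκ0 : κ 0 = uh := rfl
  have hκs : ∀ (i : ℕ) (y : Site (F.P K) (i + 1)),
      κ (i + 1) y = (vframeU (gaugeActT (κ i) (dbarIterU i X)) y)⁻¹ * κ i (emb y) * vframeU (dbarIterU i X) y := fun _ _ => rfl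
  have heff := dbarIterU_gaugeActT_eq_effGauge X uh κ hκ0 hκs (K - n)
  rw [heff, axialT_gaugeActT]
  obtain ⟨hG0, hGy⟩ := hG gJ u₁ W A c₁ c' hInAk hInAx htower htopax hu₁SU hW hc'0 hwin8 hcσ hexp hcube h129 κ (hκ0.trans huh) hκs
  have hGyc := hGy yc hyc
  -- LETTERS for the comb estimate
  obtain ⟨V, hV⟩ : ∃ V : GaugeField (F.P K) (K - n) (Matrix (Fin 2) (Fin 2) ℂ)ˣ, V = dbarIterU (K - n) X := ⟨_, rfl⟩
  rw [← hV]
  obtain ⟨z₀, hz₀⟩ : ∃ z₀ : LSite (F.P K).d, z₀ = fun μ => ((iterBlockOf (K - n) x₀ μ).val : ℤ) := ⟨_, rfl⟩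
  have htl : ∀ r : LSite (F.P K).d, transl (iterBlockOf (K - n) x₀) r = coverAt (F.P K) (K - n) (z₀ + r) := by
    intro r; funext ν
    simp only [transl_apply, Node00.coverAt_apply, Pi.add_apply, Int.cast_add, hz₀, Int.cast_natCast, ZMod.natCast_zmod_val]
  have hCU' := hCU gJ hInAk hInAx
  have hP' := hP gJ hInAk hInAx
  have hrel : rel (iterBlockOf (K - n) x₀) (coverAt (F.P K) (K - n) yc) = yc - z₀ := by
    rw [hz₀]; exact rel_coverAt_eq hk x₀ ha hroomW hyc
  have hl1 : ((l1 (yc - z₀) : ℕ) : ℝ) ≤ (F.P K).d * (M' + ρ') := by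
    have h := l1_rel_coverAt_le hk x₀ ha hroomW yc hyc
    rw [hrel] at h
    exact_mod_cast h
  have hD0 : (0 : ℝ) ≤ (F.P K).d * (M' + ρ') := by positivity
  have hρk2 : ρk ≤ 1 / 8 := by
    have h3 : (1 : ℝ) ≤ (F.P K).d * (M' + ρ') := by
      have : (1 : ℝ) ≤ M' := by exact_mod_cast hM'
      have hd : ((F.P K).d : ℝ) = 3 := by exact_mod_cast T3Family.P_d F K
      rw [hd]; linarith [(Nat.cast_nonneg ρ' : (0 : ℝ) ≤ ρ')]
    have h4 := mul_le_mul_of_nonneg_right h3 hρk0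
    linarith
  -- (F1) the axial holonomy is the ℤᵈ transport of the pulled-back double bar along the comb to the label `yc`
  have ha' : axialT V (iterBlockOf (K - n) x₀) (coverAt (F.P K) (K - n) yc) = hol (pull V (iterBlockOf (K - n) x₀)) 0 (treeWord (yc - z₀)) := by
    rw [← axialFn_pull_rel, hrel]; simp only [axialFn, sub_zero]
  -- (F3) bondwise closeness of the pulled-back double bar and the translated comb average (row R-cmp, Neumann)
  have hδ : ∀ (r : LSite (F.P K).d) (ν : Fin (F.P K).d),
      ‖((pull V (iterBlockOf (K - n) x₀) r ν : (Matrix (Fin 2) (Fin 2) ℂ)ˣ) : Matrix (Fin 2) (Fin 2) ℂ) -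
          ((avgIter (F.P K).L (pull X 0) (K - n) (z₀ + r) ν : (Matrix (Fin 2) (Fin 2) ℂ)ˣ) : Matrix (Fin 2) (Fin 2) ℂ)‖ ≤ 2 * ρk ∧
      ‖(((pull V (iterBlockOf (K - n) x₀) r ν)⁻¹ : (Matrix (Fin 2) (Fin 2) ℂ)ˣ) : Matrix (Fin 2) (Fin 2) ℂ) -
          (((avgIter (F.P K).L (pull X 0) (K - n) (z₀ + r) ν)⁻¹ : (Matrix (Fin 2) (Fin 2) ℂ)ˣ) : Matrix (Fin 2) (Fin 2) ℂ)‖ ≤ 2 * ρk := by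
    intro r ν
    rw [pull_apply, htl]
    have hx : ‖((((V ⟨coverAt (F.P K) (K - n) (z₀ + r), ν⟩)⁻¹ * avgIter (F.P K).L (pull X 0) (K - n) (z₀ + r) ν : (Matrix (Fin 2) (Fin 2) ℂ)ˣ) :
        Matrix (Fin 2) (Fin 2) ℂ)) - 1‖ ≤ ρk := by
      rw [hV]; exact hcmp gJ hInAk hInAx (z₀ + r) ν
    exact norm_sub_le_of_norm_inv_mul_sub_one_le (hCU' (z₀ + r) ν) hx (by linarith)
  -- (F4) the walk comparison `‖D̄(Γ) − Ū′(Γ)‖ ≤ 2·|Γ|·2ρk`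
  have hlen : (((treeWord (yc - z₀)).length : ℕ) : ℝ) ≤ (F.P K).d * (M' + ρ') := by rw [length_treeWord]; exact hl1
  have hwalk := norm_hol_sub_hol_le (pull V (iterBlockOf (K - n) x₀)) (fun r ν => avgIter (F.P K).L (pull X 0) (K - n) (z₀ + r) ν)
    (by positivity : (0 : ℝ) ≤ 2 * ρk) (fun r ν => hCU' (z₀ + r) ν) (fun r ν => (hδ r ν).1) (fun r ν => (hδ r ν).2) 0 (treeWord (yc - z₀))
    (by linarith [mul_le_mul_of_nonneg_right hlen hρk0])
  -- (F6) the tree-axial Stokes bound for the comb average's own comb holonomy (rows R-U, R-P, the top-axial gauge)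
  have hC0 : hol (fun r ν => avgIter (F.P K).L (pull X 0) (K - n) (z₀ + r) ν) 0 (treeWord (yc - z₀)) = axialFn (avgIter (F.P K).L (pull X 0) (K - n)) z₀ yc := by
    simp only [hol_comp_add, add_zero, axialFn]
  have hρ'0 : (0 : ℤ) ≤ ρ' := Int.natCast_nonneg _
  have hbox := inBox_sq_of_mem_cubeLamS hyc
  have hycLo : tLo a ρ' ≤ yc := fun ν => by
    obtain ⟨h1, _⟩ := hbox ν
    simp only [sqLo, bLo, Nat.sub_self, pow_zero, one_mul, B8Eq131Cubes.gs_zero, mul_one] at h1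
    simp only [tLo]; linarith
  have hycHi : yc ≤ tHi a M' ρ' := fun ν => by
    obtain ⟨_, h2⟩ := hbox ν
    simp only [sqHi, bHi, Nat.sub_self, pow_zero, one_mul, B8Eq131Cubes.gs_zero, mul_one] at h2
    simp only [tHi]; linarith
  have hz₀Lo : tLo a ρ' ≤ z₀ := fun ν => by rw [hz₀]; simp only [tLo]; linarith [(ha ν).1]
  have hz₀Hi : z₀ ≤ tHi a M' ρ' := fun ν => by rw [hz₀]; simp only [tHi]; linarith [(ha ν).2]
  have hStokes := norm_axialFn_sub_one_le_of_treeAxial (avgIter (F.P K).L (pull X 0) (K - n)) hCU' hp0 hP' htopax hz₀Lo hz₀Hi hycLo hycHi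
  rw [← hC0] at hStokes
  have hco : ∀ i, ((((tHi a M' ρ' - tLo a ρ') i).natAbs : ℕ) : ℤ) = (M' : ℤ) - 1 + 4 * ρ' := by
    intro i
    have h1 : (1 : ℤ) ≤ M' := by exact_mod_cast hM'
    simp only [Pi.sub_apply, tHi, tLo]
    rw [Int.natAbs_of_nonneg (by linarith)]; ring
  have hl1T : ((l1 (tHi a M' ρ' - tLo a ρ') : ℕ) : ℝ) = (F.P K).d * ((M' : ℝ) - 1 + 4 * ρ') := by
    have h : ((l1 (tHi a M' ρ' - tLo a ρ') : ℕ) : ℤ) = (F.P K).d * ((M' : ℤ) - 1 + 4 * ρ') := by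
      unfold l1; rw [Nat.cast_sum]; simp only [hco, Finset.sum_const, Finset.card_univ, Fintype.card_fin, nsmul_eq_mul]
    have h' : ((l1 (tHi a M' ρ' - tLo a ρ') : ℕ) : ℝ) = (((l1 (tHi a M' ρ' - tLo a ρ') : ℕ) : ℤ) : ℝ) := (Int.cast_natCast _).symm
    rw [h', h]; push_cast; ring
  have hT0 : (0 : ℝ) ≤ (F.P K).d * ((M' : ℝ) - 1 + 4 * ρ') * p := by
    have h1 : (1 : ℝ) ≤ M' := by exact_mod_cast hM'
    have : (0 : ℝ) ≤ (M' : ℝ) - 1 + 4 * ρ' := by linarith [(Nat.cast_nonneg ρ' : (0 : ℝ) ≤ ρ')]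
    positivity
  -- (F7) `‖a′ − 1‖ ≤ Θ″ := d(M′+ρ′)·(d(M′−1+4ρ′)·p + 4ρk)`
  have ha1 : ‖((axialT V (iterBlockOf (K - n) x₀) (coverAt (F.P K) (K - n) yc) : (Matrix (Fin 2) (Fin 2) ℂ)ˣ) : Matrix (Fin 2) (Fin 2) ℂ) - 1‖ ≤
      (F.P K).d * (M' + ρ') * ((F.P K).d * ((M' : ℝ) - 1 + 4 * ρ') * p + 4 * ρk) := by
    rw [ha']
    refine ((norm_sub_le_norm_sub_add_norm_sub _ _ _).trans (add_le_add hwalk hStokes)).trans ?_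
    rw [hl1T]
    linarith [mul_le_mul_of_nonneg_right hlen hρk0, mul_le_mul_of_nonneg_right hl1 hT0]
  -- (F8) the three-factor algebra `G(y₀)·a′·G(y)⁻¹ − 1`
  have hΘ0 : (0 : ℝ) ≤ (F.P K).d * (M' + ρ') * ((F.P K).d * ((M' : ℝ) - 1 + 4 * ρ') * p + 4 * ρk) := by
    have h1 : (1 : ℝ) ≤ M' := by exact_mod_cast hM'
    have : (0 : ℝ) ≤ (M' : ℝ) - 1 + 4 * ρ' := by linarith [(Nat.cast_nonneg ρ' : (0 : ℝ) ≤ ρ')]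
    positivity
  obtain ⟨Θ, hΘ⟩ : ∃ Θ : ℝ, Θ = (F.P K).d * (M' + ρ') * ((F.P K).d * ((M' : ℝ) - 1 + 4 * ρ') * p + 4 * ρk) := ⟨_, rfl⟩
  rw [← hΘ] at ha1 hΘ0 hθb
  obtain ⟨G₀, hG₀⟩ : ∃ G₀ : Matrix (Fin 2) (Fin 2) ℂ, G₀ = ((κ (K - n) (iterBlockOf (K - n) x₀) : (Matrix (Fin 2) (Fin 2) ℂ)ˣ) : Matrix (Fin 2) (Fin 2) ℂ) := ⟨_, rfl⟩
  obtain ⟨G, hGd⟩ : ∃ G : Matrix (Fin 2) (Fin 2) ℂ, G = ((κ (K - n) (coverAt (F.P K) (K - n) yc) : (Matrix (Fin 2) (Fin 2) ℂ)ˣ) : Matrix (Fin 2) (Fin 2) ℂ) := ⟨_, rfl⟩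
  obtain ⟨Gi, hGi⟩ : ∃ Gi : Matrix (Fin 2) (Fin 2) ℂ, Gi = (((κ (K - n) (coverAt (F.P K) (K - n) yc))⁻¹ : (Matrix (Fin 2) (Fin 2) ℂ)ˣ) : Matrix (Fin 2) (Fin 2) ℂ) := ⟨_, rfl⟩
  obtain ⟨Aa, hAa⟩ : ∃ Aa : Matrix (Fin 2) (Fin 2) ℂ, Aa = ((axialT V (iterBlockOf (K - n) x₀) (coverAt (F.P K) (K - n) yc) : (Matrix (Fin 2) (Fin 2) ℂ)ˣ) : Matrix (Fin 2) (Fin 2) ℂ) := ⟨_, rfl⟩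
  rw [← hG₀] at hG0
  rw [← hGd] at hGyc
  rw [← hAa] at ha1
  have hGiG : Gi * G = 1 := by rw [hGi, hGd, Units.inv_mul]
  rw [Units.val_mul, Units.val_mul, ← hG₀, ← hAa, ← hGi]
  -- Neumann: `‖G⁻¹ − 1‖ ≤ (8∕7)·θG`, `‖G⁻¹‖ ≤ 8∕7`
  have hz : ‖Gi - 1‖ ≤ 8 / 7 * θG := by
    have hid : Gi - 1 = (Gi - 1) * (1 - G) + (1 - G) := by
      rw [sub_mul, one_mul, mul_sub, mul_one, hGiG]; abel
    have h1 : ‖Gi - 1‖ ≤ ‖Gi - 1‖ * θG + θG := by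
      have h2 : ‖(1 : Matrix (Fin 2) (Fin 2) ℂ) - G‖ ≤ θG := by rw [norm_sub_rev]; exact hGyc
      calc ‖Gi - 1‖ = ‖(Gi - 1) * (1 - G) + (1 - G)‖ := by rw [← hid]
        _ ≤ ‖Gi - 1‖ * ‖(1 : Matrix (Fin 2) (Fin 2) ℂ) - G‖ + ‖(1 : Matrix (Fin 2) (Fin 2) ℂ) - G‖ := (norm_add_le _ _).trans (add_le_add (norm_mul_le _ _) le_rfl)
        _ ≤ ‖Gi - 1‖ * θG + θG := add_le_add (mul_le_mul_of_nonneg_left h2 (norm_nonneg _)) h2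
    have hprod := mul_le_mul_of_nonneg_left hθG1 (norm_nonneg (Gi - 1))
    linarith
  have hGin : ‖Gi‖ ≤ 8 / 7 := by
    have h := norm_le_insert' Gi (1 : Matrix (Fin 2) (Fin 2) ℂ)
    rw [norm_one] at h
    linarith
  have hid : G₀ * Aa * Gi - 1 = (G₀ - 1) * (Aa - 1) * Gi + (G₀ - 1) * Gi + (Aa - 1) * Gi + (Gi - 1) := by noncomm_ring
  rw [hid]
  have hb1 : ‖(G₀ - 1) * (Aa - 1) * Gi‖ ≤ θG * Θ * (8 / 7) :=
    norm_mul₃_le.trans (mul_le_mul (mul_le_mul hG0 ha1 (norm_nonneg _) hθG0) hGin (norm_nonneg _) (mul_nonneg hθG0 hΘ0))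
  have hb2 : ‖(G₀ - 1) * Gi‖ ≤ θG * (8 / 7) := (norm_mul_le _ _).trans (mul_le_mul hG0 hGin (norm_nonneg _) hθG0)
  have hb3 : ‖(Aa - 1) * Gi‖ ≤ Θ * (8 / 7) := (norm_mul_le _ _).trans (mul_le_mul ha1 hGin (norm_nonneg _) hΘ0)
  have hsum := (norm_add_le _ _).trans (add_le_add ((norm_add_le _ _).trans (add_le_add ((norm_add_le _ _).trans (add_le_add hb1 hb2)) hb3)) hz)
  refine hsum.trans ?_
  have hprod := mul_le_mul_of_nonneg_right hθG1 hΘ0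
  linarith

end Summit.QuantumFields.YangMills.Theorems.HalvingHStokesRowOfCombDefectS

end
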